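import Literature.Analysis.OperatorTheory.NuclearAlongHilbertBasis
import HarnessLib

/-!
# Nuclearity along an orthogonal decomposition into finite-dimensional blocks: `Σ_i dim V_i · ‖T|_{V_i}‖ < ∞` gives a Hilbert basis `e`
# adapted to the blocks with `Σ_k ‖T e_k‖ < ∞`, hence the three trace-class clauses (Reed–Simon I, Thm. VI.18, VI.24; Knapp, proof of Thm. 10.2)

Topic `Literature/Analysis/OperatorTheory`; theorems only (no definition, no named fact, no instance); continuation of ★ `NuclearAlongHilbertBasis`
(node H0: `Σ_k ‖T e_k‖ < ∞` along ONE Hilbert basis ⇒ Hilbert–Schmidt along every basis, summable diagonal, basis-free sum) and ★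
`HilbertSchmidtOrthogonalSum` (`exists_hilbertBasis_sigma`: the collected Hilbert basis of an orthogonal sum).  This is node H2 of the in-house road to the
automorphic letter ★ `Literature.NumberTheory.Automorphic.UnitaryGroup.ArchIntegratedOperatorTraceClass` ([Knapp1986, Thm. 10.2], cell `hodgecm-mathlib`, line T1a):
in Knapp's proof the Hilbert space of an admissible representation is the orthogonal sum `E = ⊕̂_τ E(τ)` of its FINITE-DIMENSIONAL `K`-isotypic blocks, and
`π(f)` is estimated block by block, `‖π(f)|_{E(τ)}‖ ≤ c_τ` with `Σ_τ dim E(τ) · c_τ < ∞`; along the collected orthonormal bases of the blocks this is exactly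
`Σ_k ‖π(f) e_k‖ < ∞`.  The present file is the pure Hilbert-space form of that step (no group): blocks `V i`, pairwise orthogonal, finite-dimensional, with
dense sum.

* `exists_hilbertBasis_mem_blocks` — a Hilbert basis `e : (Σ i, Fin (dim V_i)) → E` with `e ⟨i, k⟩ ∈ V_i`;
* `exists_hilbertBasis_summable_norm_apply_of_blocks` — if `‖T v‖ ≤ c_i ‖v‖` on `V_i` and `Σ_i dim V_i · c_i < ∞`, that basis has `Σ_k ‖T e_k‖ < ∞`
  (with the bound `Σ_k ‖T e_k‖ ≤ Σ_i dim V_i · c_i`);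
* `traceClass_clauses_of_blocks` — hence (★ H0) `T` is Hilbert–Schmidt along every Hilbert basis, with summable, basis-free diagonal.

## References
* M. Reed, B. Simon, *Methods of Modern Mathematical Physics I: Functional Analysis* (1972), Thm. II.6, §VI.6 Thm. VI.18, VI.24 [ReedSimon1972].
* A. W. Knapp, *Representation Theory of Semisimple Groups: An Overview Based on Examples* (1986), Thm. 10.2 (proof) [Knapp1986].
-/

noncomputable section

open Filter
open scoped Topology InnerProductSpace ENNReal NNReal

namespace Literature.Analysis.OperatorTheory

variable {E : Type*} [NormedAddCommGroup E] [InnerProductSpace ℂ E] [CompleteSpace E]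
variable {ι : Type*} {V : ι → Submodule ℂ E}

/-- **A Hilbert basis adapted to an orthogonal decomposition into finite-dimensional blocks**: if the `V_i` are pairwise orthogonal, finite-dimensional,
with dense sum (`(⨆ i, V_i)ᗮ = 0`), the collected orthonormal bases of the blocks form a Hilbert basis `e : (Σ i, Fin (dim V_i)) → E` of `E` with `e ⟨i, k⟩ ∈ V_i`.
[cite: ReedSimon1972, Thm. II.6] -/
theorem exists_hilbertBasis_mem_blocks [∀ i, FiniteDimensional ℂ (V i)]
    (hV : OrthogonalFamily ℂ (fun i => V i) fun i => (V i).subtypeₗᵢ) (hdense : (⨆ i, V i)ᗮ = ⊥) :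
    ∃ B : HilbertBasis (Σ i, Fin (Module.finrank ℂ (V i))) ℂ E, ∀ p, B p ∈ V p.1 := by
  haveI : ∀ i, CompleteSpace (V i) := fun i => FiniteDimensional.complete ℂ (V i)
  obtain ⟨B, hB⟩ := exists_hilbertBasis_sigma hV hdense fun i => (stdOrthonormalBasis ℂ (V i)).toHilbertBasis
  exact ⟨B, fun p => by rw [hB p]; exact Submodule.coe_mem _⟩

/-- **Block-nuclear ⇒ nuclear along the adapted basis**: with blocks as above, a bounded `T` with `‖T v‖ ≤ c_i ‖v‖` on `V_i` and `Σ_i dim V_i · c_i < ∞`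
satisfies `Σ_k ‖T e_k‖ < ∞` along the adapted Hilbert basis, indeed `Σ_k ‖T e_k‖ ≤ Σ_i dim V_i · c_i`. [cite: ReedSimon1972, Thm. VI.24] [cite: Knapp1986, Thm. 10.2 (proof)] -/
theorem exists_hilbertBasis_summable_norm_apply_of_blocks [∀ i, FiniteDimensional ℂ (V i)]
    (hV : OrthogonalFamily ℂ (fun i => V i) fun i => (V i).subtypeₗᵢ) (hdense : (⨆ i, V i)ᗮ = ⊥)
    (T : E →L[ℂ] E) (c : ι → ℝ) (hc : ∀ i, ∀ v ∈ V i, ‖T v‖ ≤ c i * ‖v‖)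
    (hsum : Summable fun i => (Module.finrank ℂ (V i) : ℝ) * c i) :
    ∃ B : HilbertBasis (Σ i, Fin (Module.finrank ℂ (V i))) ℂ E,
      (∀ p, B p ∈ V p.1) ∧ (Summable fun p => ‖T (B p)‖) ∧ ∑' p, ‖T (B p)‖ ≤ ∑' i, (Module.finrank ℂ (V i) : ℝ) * c i := by
  obtain ⟨B, hB⟩ := exists_hilbertBasis_mem_blocks hV hdense
  -- termwise bound `‖T e_{i,k}‖ ≤ c_i`
  have hle : ∀ p : Σ i, Fin (Module.finrank ℂ (V i)), ‖T (B p)‖ ≤ c p.1 := fun p => by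
    have h := hc p.1 (B p) (hB p)
    rwa [B.orthonormal.1 p, mul_one] at h
  -- the dominating family `p ↦ c p.1` is summable over the sigma type, with sum `Σ_i dim V_i · c_i`
  have hinner : ∀ i, ∑' _k : Fin (Module.finrank ℂ (V i)), c i = (Module.finrank ℂ (V i) : ℝ) * c i := fun i => by
    rw [tsum_fintype, Finset.sum_const, Finset.card_univ, Fintype.card_fin, nsmul_eq_mul]
  have hnn : ∀ p : Σ i, Fin (Module.finrank ℂ (V i)), 0 ≤ c p.1 := fun p => (norm_nonneg _).trans (hle p)
  have hdom : Summable fun p : Σ i, Fin (Module.finrank ℂ (V i)) => c p.1 := by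
    refine (summable_sigma_of_nonneg hnn).2 ⟨fun i => ?_, ?_⟩
    · exact (hasSum_fintype _).summable
    · simpa only [hinner] using hsum
  have hs : Summable fun p => ‖T (B p)‖ := Summable.of_nonneg_of_le (fun _ => norm_nonneg _) hle hdom
  refine ⟨B, hB, hs, ?_⟩
  calc ∑' p, ‖T (B p)‖ ≤ ∑' p : Σ i, Fin (Module.finrank ℂ (V i)), c p.1 := hs.tsum_le_tsum hle hdom
    _ = ∑' i, ∑' _k : Fin (Module.finrank ℂ (V i)), c i := hdom.tsum_sigma' (fun i => (hasSum_fintype _).summable)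
    _ = ∑' i, (Module.finrank ℂ (V i) : ℝ) * c i := tsum_congr hinner

/-- **BLOCK-NUCLEAR ⇒ THE THREE TRACE-CLASS CLAUSES** (the shape consumed by the automorphic letter ★ `ArchIntegratedOperatorTraceClass`): with pairwise orthogonal
finite-dimensional blocks `V_i` of dense sum, a bounded `T` with `‖T v‖ ≤ c_i ‖v‖` on `V_i` and `Σ_i dim V_i · c_i < ∞` is Hilbert–Schmidt along every Hilbert basis,
its diagonal is summable along every Hilbert basis, and the diagonal sum is basis free (★ `traceClass_clauses_of_summable_norm_apply`).
[cite: ReedSimon1972, Thm. VI.18, VI.24] [cite: Knapp1986, Thm. 10.2 (proof)] -/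
theorem traceClass_clauses_of_blocks [∀ i, FiniteDimensional ℂ (V i)]
    (hV : OrthogonalFamily ℂ (fun i => V i) fun i => (V i).subtypeₗᵢ) (hdense : (⨆ i, V i)ᗮ = ⊥)
    (T : E →L[ℂ] E) (c : ι → ℝ) (hc : ∀ i, ∀ v ∈ V i, ‖T v‖ ≤ c i * ‖v‖)
    (hsum : Summable fun i => (Module.finrank ℂ (V i) : ℝ) * c i) :
    ∀ (κ : Type*) (b : HilbertBasis κ ℂ E),
      (∑' j, (‖T (b j)‖₊ : ℝ≥0∞) ^ 2 < ∞) ∧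
      Summable (fun j => ⟪b j, T (b j)⟫_ℂ) ∧
      ∀ (κ' : Type*) (b' : HilbertBasis κ' ℂ E), ∑' j, ⟪b j, T (b j)⟫_ℂ = ∑' j, ⟪b' j, T (b' j)⟫_ℂ := by
  obtain ⟨B, -, hs, -⟩ := exists_hilbertBasis_summable_norm_apply_of_blocks hV hdense T c hc hsum
  exact traceClass_clauses_of_summable_norm_apply B T hs

/-- **The trace along the blocks**: under the same hypotheses the basis-free diagonal sum equals `Σ_i Σ_k ⟨e_{i,k}, T e_{i,k}⟩` along the adapted basis, and
`Σ_j |⟨b_j, T b_j⟩| ≤ 2 Σ_i dim V_i · c_i` along every Hilbert basis `b`. [cite: ReedSimon1972, Thm. VI.24] -/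
theorem tsum_norm_inner_apply_self_le_of_blocks [∀ i, FiniteDimensional ℂ (V i)]
    (hV : OrthogonalFamily ℂ (fun i => V i) fun i => (V i).subtypeₗᵢ) (hdense : (⨆ i, V i)ᗮ = ⊥)
    (T : E →L[ℂ] E) (c : ι → ℝ) (hc : ∀ i, ∀ v ∈ V i, ‖T v‖ ≤ c i * ‖v‖)
    (hsum : Summable fun i => (Module.finrank ℂ (V i) : ℝ) * c i) {κ : Type*} (b : HilbertBasis κ ℂ E) :
    ∑' j, ‖⟪b j, T (b j)⟫_ℂ‖ ≤ 2 * ∑' i, (Module.finrank ℂ (V i) : ℝ) * c i := by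
  obtain ⟨B, -, hs, hB⟩ := exists_hilbertBasis_summable_norm_apply_of_blocks hV hdense T c hc hsum
  exact (tsum_norm_inner_apply_self_le B T hs b).trans (by linarith)

end Literature.Analysis.OperatorTheory

end
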